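import Mathlib

/-!
# `QuadraticDigitPhases` (stmt-QuantumAdvantage-1391), line `Sketch` — cases of `stub_lowCutKatai`

Helper file SUPPORTING the conjectural LOW-cut stub `stub_lowCutKatai` (it does not close it).

`lowCutKatai_R0_le_one`: the stub's statement under the extra hypothesis `R₀ ≤ 1`.  In that case the
cut-rank hypothesis says that every cut matrix `(coeff (X_i X_j) P)_{i < c ≤ j}` has rank `0`, hence
(`entry_eq_zero_of_rank_eq_zero`, `coeff_eq_zero_of_cut`) every mixed coefficient `coeff (X_i X_j) P`,
`i ≠ j`, vanishes; since `P.totalDegree ≤ 2`, a monomial of `P` containing two distinct variables is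
exactly `X_i X_j` (`monomial_eq_of_two_mem`), so every monomial of `P` involves at most one variable,
i.e. `P` is `0`-banded.  Taking `R = 1`, `s = 0`, `Q = P`, `k = 0` shows that `P` is `(1,0)`-low, so the
hypothesis "not `(R,s)`-low" is absurd and the Kátai bound holds vacuously.  This settles the degenerate
widths of the stub (`R₀ = 0`: the cut hypothesis `rank < 0` is itself absurd; `R₀ = 1`: affine phases);
the first non-trivial width is `R₀ = 2` (cut-rank `≤ 1`, quasiseparable order one), see the lead's notes.
Mathlib only.
-/

set_option linter.dupNamespace false -- D-0017: single-problem summit ⇒ `QuantumAdvantage.QuantumAdvantage` by design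

namespace Summit.QuantumAdvantage.QuantumAdvantage.Theorems.MobiusLadderQuadraticDigitPhasesLowCutKataiCases

open Finset

/-- A square matrix over `ZMod 2` of rank `0` has all entries equal to `0`. [folklore] -/
theorem entry_eq_zero_of_rank_eq_zero {n : ℕ} (A : Matrix (Fin n) (Fin n) (ZMod 2))
    (h : A.rank = 0) (i j : Fin n) : A i j = 0 := by
  have hbot : LinearMap.range A.mulVecLin = ⊥ := Submodule.finrank_eq_zero.mp h
  have hA : A.mulVecLin = 0 := LinearMap.range_eq_bot.mp hbot
  have := congrArg (fun f : (Fin n → ZMod 2) →ₗ[ZMod 2] (Fin n → ZMod 2) => f (Pi.single j 1) i) hA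
  simpa [Matrix.mulVecLin_apply, Matrix.mulVec_single_one] using this

/-- If all cut matrices `(coeff (X_i X_j) P)_{i < c ≤ j}` have rank `< R₀ ≤ 1`, then every mixed
coefficient `coeff (X_i X_j) P` with `i < j` vanishes (use the cut `c = j`). -/
theorem coeff_eq_zero_of_cut {n : ℕ} {P : MvPolynomial (Fin n) (ZMod 2)} {R₀ : ℕ} (hR₀ : R₀ ≤ 1)
    (hcut : ∀ c : ℕ, (Matrix.of fun (i j : Fin n) => if (i : ℕ) < c ∧ c ≤ (j : ℕ) then
      MvPolynomial.coeff (Finsupp.single i 1 + Finsupp.single j 1) P else 0).rank < R₀)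
    {i j : Fin n} (hlt : (i : ℕ) < (j : ℕ)) :
    MvPolynomial.coeff (Finsupp.single i 1 + Finsupp.single j 1) P = 0 := by
  have h0 : (Matrix.of fun (i' j' : Fin n) => if (i' : ℕ) < (j : ℕ) ∧ (j : ℕ) ≤ (j' : ℕ) then
      MvPolynomial.coeff (Finsupp.single i' 1 + Finsupp.single j' 1) P else 0).rank = 0 := by
    have := hcut (j : ℕ)
    omega
  have hlt' : i < j := hlt
  have := entry_eq_zero_of_rank_eq_zero _ h0 i j
  simpa [hlt'] using this

/-- In a polynomial of total degree `≤ 2`, a monomial of the support containing two distinct variables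
`i ≠ j` is exactly `X_i X_j`. [folklore] -/
theorem monomial_eq_of_two_mem {n : ℕ} {P : MvPolynomial (Fin n) (ZMod 2)} (hP : P.totalDegree ≤ 2)
    {m : Fin n →₀ ℕ} (hm : m ∈ P.support) {i j : Fin n} (hij : i ≠ j) (hi : i ∈ m.support)
    (hj : j ∈ m.support) : m = Finsupp.single i 1 + Finsupp.single j 1 := by
  have hdeg : (m.sum fun _ e => e) ≤ 2 := (MvPolynomial.le_totalDegree hm).trans hP
  have hsum : (m.sum fun _ e => e) = ∑ k, m k := Finsupp.sum_fintype _ _ (fun _ => rfl)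
  rw [hsum] at hdeg
  rw [Finsupp.mem_support_iff] at hi hj
  have h2 : m i + m j ≤ 2 := by
    have hle : ∑ k ∈ ({i, j} : Finset (Fin n)), m k ≤ ∑ k, m k :=
      Finset.sum_le_sum_of_subset (Finset.subset_univ _)
    rw [Finset.sum_pair hij] at hle
    omega
  have h3 : ∀ k, k ≠ i → k ≠ j → m i + m j + m k ≤ 2 := by
    intro k hki hkj
    have hle : ∑ l ∈ ({i, j, k} : Finset (Fin n)), m l ≤ ∑ l, m l :=
      Finset.sum_le_sum_of_subset (Finset.subset_univ _)
    have hi' : i ∉ ({j, k} : Finset (Fin n)) := by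
      simp only [Finset.mem_insert, Finset.mem_singleton, not_or]
      exact ⟨hij, fun h => hki h.symm⟩
    rw [Finset.sum_insert hi', Finset.sum_pair (fun h => hkj h.symm)] at hle
    omega
  ext k
  simp only [Finsupp.coe_add, Pi.add_apply, Finsupp.single_apply]
  by_cases hki : k = i
  · subst hki
    rw [if_pos rfl, if_neg (Ne.symm hij)]
    omega
  · by_cases hkj : k = j
    · subst hkj
      rw [if_neg (fun h => hki h.symm), if_pos rfl]
      omega
    · rw [if_neg (fun h => hki h.symm), if_neg (fun h => hkj h.symm)]
      have := h3 k hki hkj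
      omega

/-- `stub_lowCutKatai` in the degenerate widths `R₀ ≤ 1`: then the cut hypothesis forces `P` to be
`0`-banded, so with `R = 1`, `s = 0` the hypothesis "not `(R,s)`-low" fails (`Q = P`, `k = 0`) and the
conclusion holds vacuously. -/
theorem lowCutKatai_R0_le_one :
    ∀ B : ℕ, ∀ τ : ℝ, 0 < τ → ∀ R₀ : ℕ, R₀ ≤ 1 → ∃ R s : ℕ, ∀ n : ℕ, ∀ P : MvPolynomial (Fin n) (ZMod 2), P.totalDegree ≤ 2 → (∀ c : ℕ, (Matrix.of fun (i j : Fin n) => if (i : ℕ) < c ∧ c ≤ (j : ℕ) then MvPolynomial.coeff (Finsupp.single i 1 + Finsupp.single j 1) P else 0).rank < R₀) → ¬ (∃ Q : MvPolynomial (Fin n) (ZMod 2), Q.totalDegree ≤ 2 ∧ (∀ m ∈ Q.support, ∀ i ∈ m.support, ∀ j ∈ m.support, Nat.dist i j ≤ s) ∧ ∃ k : ℕ, k < R ∧ ∃ u v : Fin k → Fin n → ZMod 2, ∀ x : Fin n → ZMod 2, MvPolynomial.eval x P = MvPolynomial.eval x Q + ∑ t : Fin k, (∑ i : Fin n, u t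 i * x i) * (∑ i : Fin n, v t i * x i)) → ∀ p q : ℕ, p.Prime → q.Prime → p ≠ q → 2 < p → 2 < q → p ≤ B → q ≤ B → ∀ M : ℕ, M ≤ 2 ^ n → 2 ^ n ≤ 2 * B * M → |∑ m ∈ Icc 1 M, (if MvPolynomial.eval (fun i : Fin n => if Nat.testBit (p * m) i then (1 : ZMod 2) else 0) P = 1 then (-1 : ℝ) else 1) * (if MvPolynomial.eval (fun i : Fin n => if Nat.testBit (q * m) i then (1 : ZMod 2) else 0) P = 1 then (-1 : ℝ) else 1)| ≤ τ * M := by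
  intro B τ _hτ R₀ hR₀
  refine ⟨1, 0, ?_⟩
  intro n P hdeg hcut hnotlow
  exfalso
  apply hnotlow
  refine ⟨P, hdeg, ?_, 0, Nat.one_pos, fun t => t.elim0, fun t => t.elim0, fun x => by simp⟩
  intro m hm i hi j hj
  by_contra hne
  have hij : i ≠ j := by
    rintro rfl
    exact hne (by simp)
  have hcoeff : MvPolynomial.coeff m P ≠ 0 := MvPolynomial.mem_support_iff.mp hm
  rcases lt_or_gt_of_ne (Fin.val_injective.ne hij) with hlt | hgt
  · rw [monomial_eq_of_two_mem hdeg hm hij hi hj] at hcoeff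
    exact hcoeff (coeff_eq_zero_of_cut hR₀ hcut hlt)
  · rw [monomial_eq_of_two_mem hdeg hm hij.symm hj hi] at hcoeff
    exact hcoeff (coeff_eq_zero_of_cut hR₀ hcut hgt)

end Summit.QuantumAdvantage.QuantumAdvantage.Theorems.MobiusLadderQuadraticDigitPhasesLowCutKataiCases
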